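import Summits.QuantumFields.YangMills.Theorems.FlatTubeReductionDiagonalMomentSandwichCore
import HarnessLib

/-!
# The two Haar MOMENTS of the diagonal Laplace exponent, pointwise in the fibre/gauge datum: `∫_d|X − X₁| ≤ E₂(p)`, `∫_d X²e^{|X|} ≤ (E₁ + E₂)²e^{E₁+E₂}`,
# with lane A's explicit `E₁(p)`, `E₂(p)` (uniform over the colour rotation of `u`)
# (route `FlatTubeReduction`, crux K1 `NearFlatRatioLaw` stmt-QuantumFields-24720; seat `ym-line-ftr-p1` g12; rate twin «ratepack-v3 / frozen fibres»; R2b1 RECORD rung — no summit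
# statement is proved here)

WHY (memo `Cruxes/NearFlatRatioLaw/Lines/ratepack-v3-frozen-g12.md` §§5.6–5.8, brick (vii)).  The core+tail sandwich `…DiagonalMomentSandwichCore.fpBOKernel_diag_two_sided_moment_core`
takes pointwise bounds `B p` and the moment weights `M₂(p) = ∫_d|X − X₁|`, `M_R(p) = ∫_d X²e^{|X|}`.  RED lane A's (L3) algebra (`abs_diagX1_le`, `abs_diagX_sub_diagX1_le`, rotation
invariance `abs_adRot_slowLin_apply_le` / `abs_vecPart_conj_apply_le` / `norm_vecPart_conj_le`) bounds `|X₁(d,p)| ≤ E₁(p)` and `|X(d,p) − X₁(d,p)| ≤ E₂(p)` UNIFORMLY in `d`, with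
`E₁, E₂` explicit polynomials in `τ_u` (size of the slow datum), `‖v̂‖, ‖v̂′‖`, `‖g⃗_y‖‖M⃗_e‖`, `σ`, `τ` — lane A feeds SUPs of these into `ε₁, ε₂`; the moment machine feeds the same
POINTWISE expressions into the layer cake (they are polynomial in the Gaussian level on the core).  This file extracts the two uniform bounds and the resulting moment weights:
* ★ `abs_diagX1_conj_le_E1`, ★ `abs_diagX_conj_sub_diagX1_le_E2` — the uniform-in-`d` bounds (lane A's `h1`, `h2` made public);
* ★★ `haarMoment2_le_E2` — `M₂(p) ≤ E₂(p)`;  ★★ `haarMomentR_le` — `M_R(p) ≤ (E₁ + E₂)²·e^{E₁ + E₂}`;  `abs_diagX_conj_le_E` — `|X| ≤ E₁ + E₂` (the `B p` of the sandwich).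
HONEST FRAMING: bookkeeping of lane A's pointwise algebra; femto rung R2b1 (RECORD label); not infinite volume, not a gap, not Clay.  No defs, no named facts, no `sorry`.
-/

set_option autoImplicit false

noncomputable section

open MeasureTheory Filter Topology Real
open scoped BigOperators Matrix InnerProductSpace RealInnerProductSpace
open Literature.MathematicalPhysics.QuantumFieldTheory
open Literature.MathematicalPhysics.QuantumLattice

namespace Summit.QuantumFields.YangMills.Theorems.FemtoTransferGap.RateTube

open Summit.QuantumFields.YangMills.Theorems.FemtoTransferGap
open Summit.QuantumFields.YangMills.Theorems.FemtoTransferGap.TwoLattice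
open Summit.QuantumFields.YangMills.Theorems.FemtoTransferGap.TwoLattice.ConstTube
open Summit.QuantumFields.YangMills.Theorems.FemtoTransferGap.TwoLattice.Avg
open Summit.QuantumFields.YangMills.Theorems.FemtoTransferGap.TwoLattice.Cov
open Summit.QuantumFields.YangMills.Theorems.FemtoTransferGap.TwoLattice.Toron
open Summit.QuantumFields.YangMills.Theorems.FemtoTransferGap.TwoLattice.Stiff (LinkSpace)

variable {L : ℕ} [NeZero L]

/-! ## §1 ★ The uniform-in-`d` pointwise bounds -/

/-- ★ **First order, uniformly over the conjugates**: `|diagX1 β (slowLin(dud⁻¹)) v v′ g| ≤ E₁(p) = β(12Σ_e 2τ_u‖g⃗_y‖‖M⃗_e‖) + β(40·2τ_u·N_P(‖v̂‖² + ‖v̂′‖²))`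
whenever `Σ_a u⃗_{k,a}² ≤ τ_u²`. [cite: Luscher1983, §3] -/
theorem abs_diagX1_conj_le_E1 {β : ℝ} (hβ : 0 ≤ β) (u : GaugeConfig 3 1 SU2) (v v' : Edge 3 L → Fin 3 → ℝ) {τu : ℝ} (hτu0 : 0 ≤ τu)
    (hu : ∀ k : Fin 3, ∑ a, vecPart (u (0, k)) a ^ 2 ≤ τu ^ 2) (g : Site 3 L → SU2) (d : SU2) :
    |diagX1 L β (slowLin (gaugeTransform (fun _ : Site 3 1 => d) u)) v v' g| ≤
      β * (12 * ∑ e : Edge 3 L, (2 * τu) * ‖vecPart (g (e.1.shift e.2))‖ * ‖vecPart (linkM L v v' g e)‖) +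
        β * (40 * (2 * τu) * (Fintype.card (Plaquette 3 L × Fin 3) : ℝ) * (‖linkEmbed L v‖ ^ 2 + ‖linkEmbed L v'‖ ^ 2)) := by
  rw [diagX1_slowLin_conj]
  have h := abs_diagX1_le (L := L) hβ (c := fun k => (adRot d).mulVec (slowLin u k)) (α := 2 * τu) (fun k a => abs_adRot_slowLin_apply_le hτu0 hu d k a) v v' g
  refine h.trans ?_
  have hck : ∀ e : Edge 3 L, ‖(adRot d).mulVec (slowLin u e.2)‖ ≤ 2 * τu := fun e =>
    (pi_norm_le_iff_of_nonneg (by positivity)).mpr fun a => by rw [Real.norm_eq_abs]; exact abs_adRot_slowLin_apply_le hτu0 hu d e.2 a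
  have hs : ∑ e : Edge 3 L, ‖(adRot d).mulVec (slowLin u e.2)‖ * ‖vecPart (g (e.1.shift e.2))‖ * ‖vecPart (linkM L v v' g e)‖ ≤
      ∑ e : Edge 3 L, (2 * τu) * ‖vecPart (g (e.1.shift e.2))‖ * ‖vecPart (linkM L v v' g e)‖ :=
    Finset.sum_le_sum fun e _ => mul_le_mul_of_nonneg_right (mul_le_mul_of_nonneg_right (hck e) (norm_nonneg _)) (norm_nonneg _)
  nlinarith [hs]

/-- ★ **Second order, uniformly over the conjugates**: `|diagX β (dud⁻¹) v v′ g − diagX1 β (slowLin(dud⁻¹)) v v′ g| ≤ E₂(p)` with lane A's explicit `E₂`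
(hypotheses of `abs_diagX_sub_diagX1_le`, the slow datum measured rotation-invariantly by `Σ_a u⃗_{k,a}² ≤ τ_u²`). [cite: Luscher1983, §3] -/
theorem abs_diagX_conj_sub_diagX1_le_E2 {β : ℝ} (hβ : 0 ≤ β) (u : GaugeConfig 3 1 SU2) {v v' : Edge 3 L → Fin 3 → ℝ} (hv : v ∈ capBalancedSet L) (hv' : v' ∈ capBalancedSet L)
    {τ σ τu : ℝ} (hτ : τ ≤ 1 / 30) (hσ : σ < 2) (hσ0 : 0 ≤ σ) (hS : (L : ℝ) ^ 3 * wilsonAction su2Rep u ≤ σ)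
    (hvτ : ∀ (e : Edge 3 L) (c : Fin 3), |v e c| ≤ τ) (hvτ' : ∀ (e : Edge 3 L) (c : Fin 3), |v' e c| ≤ τ) (hτu0 : 0 ≤ τu) (hτu : τu ≤ 1)
    (hu : ∀ k : Fin 3, ∑ a, vecPart (u (0, k)) a ^ 2 ≤ τu ^ 2) (g : Site 3 L → SU2) (d : SU2) :
    |diagX L β (gaugeTransform (fun _ : Site 3 1 => d) u) v v' g - diagX1 L β (slowLin (gaugeTransform (fun _ : Site 3 1 => d) u)) v v' g| ≤
      β * (48 * ∑ e : Edge 3 L, τu ^ 2 * ‖vecPart (g (e.1.shift e.2))‖ * ‖vecPart (linkM L v v' g e)‖) +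
      β / 2 * ((σ / 2 * (10 * Real.sqrt (Fintype.card (Plaquette 3 L × Fin 3)) * ‖linkEmbed L v‖) ^ 2 + stepActionErr (L := L) τ σ) + stepActionErr (L := L) τ 0 +
        145000000 * (Fintype.card (Plaquette 3 L × Fin 3) : ℝ) * τu ^ 2 * ‖linkEmbed L v‖ ^ 2) +
      β / 2 * ((σ / 2 * (10 * Real.sqrt (Fintype.card (Plaquette 3 L × Fin 3)) * ‖linkEmbed L v'‖) ^ 2 + stepActionErr (L := L) τ σ) + stepActionErr (L := L) τ 0 +
        145000000 * (Fintype.card (Plaquette 3 L × Fin 3) : ℝ) * τu ^ 2 * ‖linkEmbed L v'‖ ^ 2) := by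
  have hSd : (L : ℝ) ^ 3 * wilsonAction su2Rep (gaugeTransform (fun _ : Site 3 1 => d) u) ≤ σ := by rw [wilsonAction_gaugeTransform]; exact hS
  have hud : ∀ (k : Fin 3) (a : Fin 3), |vecPart (gaugeTransform (fun _ : Site 3 1 => d) u (0, k)) a| ≤ τu := abs_vecPart_conj_apply_le hτu0 hu d
  have h := abs_diagX_sub_diagX1_le (L := L) hβ (gaugeTransform (fun _ : Site 3 1 => d) u) hv hv' hτ hσ hSd hvτ hvτ' hτu hud g
  refine h.trans ?_
  set N : ℝ := (Fintype.card (Plaquette 3 L × Fin 3) : ℝ)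
  have hn : ∀ e : Edge 3 L, ‖vecPart (gaugeTransform (fun _ : Site 3 1 => d) u (0, e.2))‖ ^ 2 ≤ τu ^ 2 := fun e =>
    pow_le_pow_left₀ (norm_nonneg _) (norm_vecPart_conj_le hτu0 hu d e.2) 2
  have hs : ∑ e : Edge 3 L, ‖vecPart (gaugeTransform (fun _ : Site 3 1 => d) u (0, e.2))‖ ^ 2 * ‖vecPart (g (e.1.shift e.2))‖ * ‖vecPart (linkM L v v' g e)‖ ≤
      ∑ e : Edge 3 L, τu ^ 2 * ‖vecPart (g (e.1.shift e.2))‖ * ‖vecPart (linkM L v v' g e)‖ :=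
    Finset.sum_le_sum fun e _ => mul_le_mul_of_nonneg_right (mul_le_mul_of_nonneg_right (hn e) (norm_nonneg _)) (norm_nonneg _)
  have hD : ∀ w : LinkSpace L, ‖covCurl (constLift L (gaugeTransform (fun _ : Site 3 1 => d) u)) w‖ ^ 2 ≤ (10 * Real.sqrt N * ‖w‖) ^ 2 := fun w =>
    pow_le_pow_left₀ (norm_nonneg _) (norm_covCurl_le_op _ w) 2
  have hDv := hD (linkEmbed L v)
  have hDv' := hD (linkEmbed L v')
  have hβ2 : 0 ≤ β / 2 := by linarith
  have hσ4 : 0 ≤ σ / 2 := by linarith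
  nlinarith [mul_le_mul_of_nonneg_left hs (by positivity : (0 : ℝ) ≤ β * 48), mul_le_mul_of_nonneg_left (mul_le_mul_of_nonneg_left hDv hσ4) hβ2,
    mul_le_mul_of_nonneg_left (mul_le_mul_of_nonneg_left hDv' hσ4) hβ2]

/-! ## §2 ★★ The moment weights -/

/-- ★★ **`M₂(p) ≤ E₂(p)`**: the Haar moment of the second-order part is bounded by ANY uniform-in-`d` bound `E₂` of it (apply with `abs_diagX_conj_sub_diagX1_le_E2`). [folklore] -/
theorem haarMoment2_le (β : ℝ) (u : GaugeConfig 3 1 SU2) (v v' : Edge 3 L → Fin 3 → ℝ) (g : Site 3 L → SU2) {E₂ : ℝ}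
    (h2 : ∀ d : SU2, |diagX L β (gaugeTransform (fun _ : Site 3 1 => d) u) v v' g - diagX1 L β (slowLin (gaugeTransform (fun _ : Site 3 1 => d) u)) v v' g| ≤ E₂) :
    ∫ d, |diagX L β (gaugeTransform (fun _ : Site 3 1 => d) u) v v' g - diagX1 L β (slowLin (gaugeTransform (fun _ : Site 3 1 => d) u)) v v' g| ∂haarProbability SU2 ≤ E₂ := by
  have hm : Measurable fun d : SU2 => |diagX L β (gaugeTransform (fun _ : Site 3 1 => d) u) v v' g - diagX1 L β (slowLin (gaugeTransform (fun _ : Site 3 1 => d) u)) v v' g| :=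
    ((measurable_diagX_conj β u v v' g).sub (measurable_diagX1_conj β u v v' g)).abs
  have hi : Integrable (fun d : SU2 => |diagX L β (gaugeTransform (fun _ : Site 3 1 => d) u) v v' g - diagX1 L β (slowLin (gaugeTransform (fun _ : Site 3 1 => d) u)) v v' g|)
      (haarProbability SU2) := integrable_of_measurable_abs_le _ hm (C := E₂) fun d => by rw [abs_abs]; exact h2 d
  calc ∫ d, |diagX L β (gaugeTransform (fun _ : Site 3 1 => d) u) v v' g - diagX1 L β (slowLin (gaugeTransform (fun _ : Site 3 1 => d) u)) v v' g| ∂haarProbability SU2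
      ≤ ∫ _d : SU2, E₂ ∂haarProbability SU2 := integral_mono hi (integrable_const E₂) h2
    _ = E₂ := by simp

/-- `|X(d,p)| ≤ E₁ + E₂` from the two uniform bounds (the pointwise bound `B p` of the core+tail sandwich). [folklore] -/
theorem abs_diagX_conj_le_of_bounds (β : ℝ) (u : GaugeConfig 3 1 SU2) (v v' : Edge 3 L → Fin 3 → ℝ) (g : Site 3 L → SU2) {E₁ E₂ : ℝ}
    (h1 : ∀ d : SU2, |diagX1 L β (slowLin (gaugeTransform (fun _ : Site 3 1 => d) u)) v v' g| ≤ E₁)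
    (h2 : ∀ d : SU2, |diagX L β (gaugeTransform (fun _ : Site 3 1 => d) u) v v' g - diagX1 L β (slowLin (gaugeTransform (fun _ : Site 3 1 => d) u)) v v' g| ≤ E₂) (d : SU2) :
    |diagX L β (gaugeTransform (fun _ : Site 3 1 => d) u) v v' g| ≤ E₁ + E₂ := by
  have e : diagX L β (gaugeTransform (fun _ : Site 3 1 => d) u) v v' g = diagX1 L β (slowLin (gaugeTransform (fun _ : Site 3 1 => d) u)) v v' g +
      (diagX L β (gaugeTransform (fun _ : Site 3 1 => d) u) v v' g - diagX1 L β (slowLin (gaugeTransform (fun _ : Site 3 1 => d) u)) v v' g) := by ring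
  rw [e]
  exact (abs_add_le _ _).trans (add_le_add (h1 d) (h2 d))

/-- ★★ **`M_R(p) ≤ (E₁ + E₂)²·e^{E₁+E₂}`**: the Haar moment of the remainder weight `X²e^{|X|}` from the two uniform bounds. [folklore] -/
theorem haarMomentR_le (β : ℝ) (u : GaugeConfig 3 1 SU2) (v v' : Edge 3 L → Fin 3 → ℝ) (g : Site 3 L → SU2) {E₁ E₂ : ℝ}
    (h1 : ∀ d : SU2, |diagX1 L β (slowLin (gaugeTransform (fun _ : Site 3 1 => d) u)) v v' g| ≤ E₁)
    (h2 : ∀ d : SU2, |diagX L β (gaugeTransform (fun _ : Site 3 1 => d) u) v v' g - diagX1 L β (slowLin (gaugeTransform (fun _ : Site 3 1 => d) u)) v v' g| ≤ E₂) :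
    ∫ d, diagX L β (gaugeTransform (fun _ : Site 3 1 => d) u) v v' g ^ 2 * Real.exp |diagX L β (gaugeTransform (fun _ : Site 3 1 => d) u) v v' g| ∂haarProbability SU2 ≤
      (E₁ + E₂) ^ 2 * Real.exp (E₁ + E₂) := by
  have hB := abs_diagX_conj_le_of_bounds β u v v' g h1 h2
  have hE0 : 0 ≤ E₁ + E₂ := (abs_nonneg _).trans (hB 1)
  have hXm : Measurable fun d : SU2 => diagX L β (gaugeTransform (fun _ : Site 3 1 => d) u) v v' g := measurable_diagX_conj β u v v' g
  have hpt : ∀ d : SU2, diagX L β (gaugeTransform (fun _ : Site 3 1 => d) u) v v' g ^ 2 * Real.exp |diagX L β (gaugeTransform (fun _ : Site 3 1 => d) u) v v' g| ≤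
      (E₁ + E₂) ^ 2 * Real.exp (E₁ + E₂) := fun d => by
    have h := hB d
    have hsq : diagX L β (gaugeTransform (fun _ : Site 3 1 => d) u) v v' g ^ 2 ≤ (E₁ + E₂) ^ 2 := by
      rw [← sq_abs]; exact pow_le_pow_left₀ (abs_nonneg _) h 2
    exact mul_le_mul hsq (Real.exp_le_exp.mpr h) (Real.exp_pos _).le (by positivity)
  have hi : Integrable (fun d : SU2 => diagX L β (gaugeTransform (fun _ : Site 3 1 => d) u) v v' g ^ 2 * Real.exp |diagX L β (gaugeTransform (fun _ : Site 3 1 => d) u) v v' g|)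
      (haarProbability SU2) :=
    integrable_of_measurable_abs_le _ ((hXm.pow_const 2).mul (Real.measurable_exp.comp hXm.abs)) (C := (E₁ + E₂) ^ 2 * Real.exp (E₁ + E₂)) fun d => by
      rw [abs_of_nonneg (mul_nonneg (sq_nonneg _) (Real.exp_pos _).le)]; exact hpt d
  calc ∫ d, diagX L β (gaugeTransform (fun _ : Site 3 1 => d) u) v v' g ^ 2 * Real.exp |diagX L β (gaugeTransform (fun _ : Site 3 1 => d) u) v v' g| ∂haarProbability SU2
      ≤ ∫ _d : SU2, (E₁ + E₂) ^ 2 * Real.exp (E₁ + E₂) ∂haarProbability SU2 := integral_mono hi (integrable_const _) hpt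
    _ = (E₁ + E₂) ^ 2 * Real.exp (E₁ + E₂) := by simp

end Summit.QuantumFields.YangMills.Theorems.FemtoTransferGap.RateTube

end
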